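import Mathlib
import HarnessLib
import Literature.MathematicalPhysics.QuantumFieldTheory.FariaDaVeigaOCarroll2022.FdVOC22MultiReflectionBound
import Literature.MathematicalPhysics.QuantumLattice.CloverPseudoscalarParity
import Literature.MathematicalPhysics.QuantumLattice.CloverObservables
import Summits.Ventures.LatticeQCDFlow.Scoring.WilsonFlowRK3Consistency

/-!
# Reflection positivity for the FLOWED ENERGY: for every reflection-covariant smoothing map `Φ`, a centred combination of `S_x ∘ Φ` correlates NON-NEGATIVELY with its mirror image as soon as it is supported in the half-space — and the engine's RK3 flow is such a map

HONEST FRAMING: exact (Metropolis-corrected) sampling algorithms for lattice gauge theory;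
figures of merit are autocorrelation/cost numbers at stated couplings and volumes; no
continuum-physics claim.

Venture `LatticeQCDFlow` (cell pub-lqcd), topic `Exactness`, FANOUT row 21 (`su3-base`: the row's second scored observable is the
FLOWED clover energy `t²E`, `E_x ∘ RK3_{ε'}^m`, and the open-boundary arm reads its slab profile).  The `0⁺⁺` companion of row 21's
`Exactness/FlowedChargeCorrelatorRP`: what reflection positivity needs from a smoothing map `Φ` is (a) COVARIANCE `Φ(Θ'U) = Θ'(ΦU)`
and (b) SUPPORT of the smoothed observable in the positive half.  Given (a), the Literature's evenness of the clover energy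
density (`CloverPseudoscalarParity.flowedCloverEnergy_zero_reflect`) makes `S_x ∘ Φ` EVEN, so the Osterwalder–Seiler form of any
centred combination is `≥ 0` (the Literature's `FariaDaVeigaOCarroll2022.integral_mul_negReflect_nonneg`, every `β`, site plane;
`integral_mul_timeReflect_nonneg`, `β ≥ 0`, link plane).  Row 16's `Scoring/WilsonFlowRK3Reflection.iterate_wilsonFlowRK3_negReflect`
(via `WilsonFlowRK3Consistency`) supplies (a) for the engine's RK3 integrator and the site reflection; (b) stays an explicit
HYPOTHESIS.  NEW WORK of the cell, def-free; nothing is cited as a fact; no number.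

* §1 ABSTRACT (any compact `G`, continuous unitary `ρ`, even `L`, any measurable `Φ`, any constant `a`):
  **`integral_flowedEnergy_sub_mul_negReflect_nonneg`** — if `Φ ∘ Θ' = Θ' ∘ Φ` and `F = Σ_k c_k S_{y_k} ∘ Φ − a` depends only on
  the site-positive and shared links, then `0 ≤ ∫ F · (Σ_k c_k S_{θ'y_k} ∘ Φ − a) dμ_β` for EVERY `β`;
  **`integral_flowedEnergy_sub_mul_timeReflect_nonneg`** — the same across the link plane (`β ≥ 0`).
* §2 THE ENGINE'S FLOW (`SU(n)`, fundamental representation, every `β`, `ε'`, `m`, `a`):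
  **`integral_rk3Energy_sub_mul_negReflect_nonneg`** and the slab form **`integral_rk3SlabEnergy_sub_mul_negReflect_nonneg`** —
  with `E_{m,t} = Σ_{x₀ = t} S_x ∘ RK3^m` supported in the half-space, `⟨(E_{m,t} − a)·((Σ_{x₀ = t} S_{θ'x} ∘ RK3^m) − a)⟩_β ≥ 0`
  (the second factor is the flowed energy of the mirror slice `−t`; with `a = ⟨E_{m,t}⟩` this is the connected flowed
  slab-energy correlator at the reflected separation: NON-NEGATIVE).
NOT CLAIMED: the support radius of `RK3_{ε'}^m` (hypothesis `hdep`); the link-plane covariance of `RK3`; separations inside the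
smoothing footprint; numbers.
-/

noncomputable section

namespace Summit.Ventures.LatticeQCDFlow.Exactness

open MeasureTheory
open Literature.MathematicalPhysics.QuantumFieldTheory
open Literature.MathematicalPhysics.QuantumLattice (flowedCloverEnergy flowedCloverEnergy_zero_reflect continuous_flowedCloverEnergy_zero
  exists_abs_flowedCloverEnergy_zero_le fundamentalRep continuous_fundamentalRep fundamentalRep_mem_unitaryGroup)
open Summit.Ventures.LatticeQCDFlow.Scoring (wilsonFlowRK3 iterate_wilsonFlowRK3_negReflect continuous_iterate_wilsonFlowRK3)

/-! ## §1 Abstract smoothing maps -/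

section Abstract

variable {L N : ℕ} [NeZero L] {G : Type*} [Group G] [TopologicalSpace G] [IsTopologicalGroup G]
  [CompactSpace G] [MeasurableSpace G] [BorelSpace G] [SecondCountableTopology G] (ρ : G →* Matrix (Fin N) (Fin N) ℂ)

omit [IsTopologicalGroup G] in
/-- A finite real combination of SMOOTHED clover energy densities minus a constant, `Σ_k c_k S_{y_k} ∘ Φ − a`, is measurable and
bounded (measurable `Φ`). -/
theorem measurable_bounded_sum_flowedCloverEnergy_comp_sub (hρc : Continuous ρ)
    {Φ : GaugeConfig 4 L G → GaugeConfig 4 L G} (hΦ : Measurable Φ) {ι : Type*} (s : Finset ι) (c : ι → ℝ) (a : ℝ)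
    (y : ι → Site 4 L) :
    Measurable (fun U : GaugeConfig 4 L G => (∑ k ∈ s, c k * flowedCloverEnergy ρ 0 (y k) (Φ U)) - a) ∧
      ∃ K : ℝ, ∀ U : GaugeConfig 4 L G, |(∑ k ∈ s, c k * flowedCloverEnergy ρ 0 (y k) (Φ U)) - a| ≤ K := by
  refine ⟨(Finset.measurable_sum s fun k _ =>
    (((continuous_flowedCloverEnergy_zero ρ hρc (y k)).measurable).comp hΦ).const_mul (c k)).sub measurable_const, ?_⟩
  choose C hC using fun k => exists_abs_flowedCloverEnergy_zero_le ρ hρc (R := ZMod L) (y k)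
  refine ⟨(∑ k ∈ s, |c k| * C k) + |a|, fun U => (abs_sub _ _).trans ?_⟩
  gcongr
  refine (Finset.abs_sum_le_sum_abs _ _).trans (Finset.sum_le_sum fun k _ => ?_)
  rw [abs_mul]
  exact mul_le_mul_of_nonneg_left (hC k (Φ U)) (abs_nonneg _)

/-- **SITE PLANE, EVERY `β`: reflection positivity for smoothed, centred energy densities.**  If `Φ(Θ'U) = Θ'(ΦU)` and
`F = Σ_k c_k S_{y_k} ∘ Φ − a` is an observable of the site-positive and shared links, then
`0 ≤ ∫ F · (Σ_k c_k S_{θ'y_k} ∘ Φ − a) dμ_β`. -/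
theorem integral_flowedEnergy_sub_mul_negReflect_nonneg (hL : Even L) (hρc : Continuous ρ)
    (hρu : ∀ g, ρ g ∈ Matrix.unitaryGroup (Fin N) ℂ) (β : ℝ) {Φ : GaugeConfig 4 L G → GaugeConfig 4 L G} (hΦ : Measurable Φ)
    (hΦΘ : ∀ U : GaugeConfig 4 L G, Φ U.negReflect = (Φ U).negReflect) {ι : Type*} (s : Finset ι) (c : ι → ℝ) (a : ℝ)
    (y : ι → Site 4 L)
    (hdep : DependsOn (fun U : GaugeConfig 4 L G => (∑ k ∈ s, c k * flowedCloverEnergy ρ 0 (y k) (Φ U)) - a)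
      ((WilsonSiteRP.sitePosEdges ∪ WilsonSiteRP.sharedEdges : Finset (Edge 4 L)) : Set (Edge 4 L))) :
    0 ≤ ∫ U, ((∑ k ∈ s, c k * flowedCloverEnergy ρ 0 (y k) (Φ U)) - a) *
        ((∑ k ∈ s, c k * flowedCloverEnergy ρ 0 (Site.negReflect (y k)) (Φ U)) - a) ∂(wilsonMeasure ρ β) := by
  obtain ⟨hFm, hFb⟩ := measurable_bounded_sum_flowedCloverEnergy_comp_sub ρ hρc hΦ s c a y
  have key := FariaDaVeigaOCarroll2022.integral_mul_negReflect_nonneg ρ hL hρc β hFm hFb hdep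
  -- the energy density is even: `S_x(Θ'W) = S_{θ'x}(W)` (Literature parity, instantiated on the torus)
  have heven : ∀ (W : GaugeConfig 4 L G) (x : Site 4 L),
      flowedCloverEnergy ρ 0 x W.negReflect = flowedCloverEnergy ρ 0 (Site.negReflect x) W := fun W x =>
    flowedCloverEnergy_zero_reflect ρ hρu (Site.negReflect (d := 4) (L := L))
      (fun z => by funext k; by_cases hk : k = 0 <;> [(subst hk; simp [Site.negReflect]; ring); simp [Site.negReflect, hk]])
      (fun z i hi => by funext k; by_cases hk : k = 0 <;> [(subst hk; simp [Site.negReflect, hi.symm]); simp [Site.negReflect, hk]])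
      W W.negReflect (fun z => by unfold GaugeConfig.negReflect; rw [if_pos rfl]; rfl)
      (fun z i hi => by unfold GaugeConfig.negReflect; rw [if_neg hi]) x
  simp only [hΦΘ, heven] at key
  exact key

/-- **LINK PLANE, `β ≥ 0`: reflection positivity for smoothed, centred energy densities.**  If `Φ(ΘU) = Θ(ΦU)` and
`F = Σ_k c_k S_{y_k} ∘ Φ − a` is an observable of the positive-time links, then `0 ≤ ∫ F · (Σ_k c_k S_{θy_k} ∘ Φ − a) dμ_β`. -/
theorem integral_flowedEnergy_sub_mul_timeReflect_nonneg (hL : Even L) (hρc : Continuous ρ)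
    (hρu : ∀ g, ρ g ∈ Matrix.unitaryGroup (Fin N) ℂ) {β : ℝ} (hβ : 0 ≤ β) {Φ : GaugeConfig 4 L G → GaugeConfig 4 L G}
    (hΦ : Measurable Φ) (hΦΘ : ∀ U : GaugeConfig 4 L G, Φ U.timeReflect = (Φ U).timeReflect) {ι : Type*} (s : Finset ι)
    (c : ι → ℝ) (a : ℝ) (y : ι → Site 4 L)
    (hdep : DependsOn (fun U : GaugeConfig 4 L G => (∑ k ∈ s, c k * flowedCloverEnergy ρ 0 (y k) (Φ U)) - a)
      {e : Edge 4 L | WilsonRP.IsPosEdge e}) :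
    0 ≤ ∫ U, ((∑ k ∈ s, c k * flowedCloverEnergy ρ 0 (y k) (Φ U)) - a) *
        ((∑ k ∈ s, c k * flowedCloverEnergy ρ 0 (Site.timeReflect (y k)) (Φ U)) - a) ∂(wilsonMeasure ρ β) := by
  obtain ⟨hFm, hFb⟩ := measurable_bounded_sum_flowedCloverEnergy_comp_sub ρ hρc hΦ s c a y
  have key := FariaDaVeigaOCarroll2022.integral_mul_timeReflect_nonneg ρ hL hρc hβ hFm hFb hdep
  have heven : ∀ (W : GaugeConfig 4 L G) (x : Site 4 L),
      flowedCloverEnergy ρ 0 x W.timeReflect = flowedCloverEnergy ρ 0 (Site.timeReflect x) W := fun W x =>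
    flowedCloverEnergy_zero_reflect ρ hρu (Site.timeReflect (d := 4) (L := L))
      (fun z => by funext k; by_cases hk : k = 0 <;> [(subst hk; simp [Site.timeReflect]); simp [Site.timeReflect, hk]])
      (fun z i hi => by funext k; by_cases hk : k = 0 <;> [(subst hk; simp [Site.timeReflect, hi.symm]); simp [Site.timeReflect, hk]])
      W W.timeReflect (fun z => by unfold GaugeConfig.timeReflect; rw [if_pos rfl]; rfl)
      (fun z i hi => by unfold GaugeConfig.timeReflect; rw [if_neg hi]) x
  simp only [hΦΘ, heven] at key
  exact key

end Abstract

/-! ## §2 The engine's RK3 Wilson flow -/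

section RK3

variable {L n : ℕ} [NeZero L]

/-- **THE ENGINE'S FLOWED ENERGY ACROSS THE SITE PLANE** (`SU(n)`, fundamental representation, every `β`, `ε'`, `m`, `a`): for
every finite combination `F = Σ_k c_k S_{y_k} ∘ RK3_{ε'}^m − a` that is an observable of the site-positive and shared links,
`0 ≤ ∫ F · (Σ_k c_k S_{θ'y_k} ∘ RK3^m − a) dμ_β`. -/
theorem integral_rk3Energy_sub_mul_negReflect_nonneg (hL : Even L) (β ε' : ℝ) (m : ℕ) {ι : Type*} (s : Finset ι)
    (c : ι → ℝ) (a : ℝ) (y : ι → Site 4 L)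
    (hdep : DependsOn (fun U : GaugeConfig 4 L (Matrix.specialUnitaryGroup (Fin n) ℂ) =>
        (∑ k ∈ s, c k * flowedCloverEnergy (fundamentalRep (Fin n)) 0 (y k) ((wilsonFlowRK3 ε')^[m] U)) - a)
      ((WilsonSiteRP.sitePosEdges ∪ WilsonSiteRP.sharedEdges : Finset (Edge 4 L)) : Set (Edge 4 L))) :
    0 ≤ ∫ U, ((∑ k ∈ s, c k * flowedCloverEnergy (fundamentalRep (Fin n)) 0 (y k) ((wilsonFlowRK3 ε')^[m] U)) - a) *
        ((∑ k ∈ s, c k * flowedCloverEnergy (fundamentalRep (Fin n)) 0 (Site.negReflect (y k)) ((wilsonFlowRK3 ε')^[m] U)) - a)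
      ∂(wilsonMeasure (d := 4) (L := L) (fundamentalRep (Fin n)) β) :=
  integral_flowedEnergy_sub_mul_negReflect_nonneg (fundamentalRep (Fin n)) hL (continuous_fundamentalRep (Fin n))
    (fundamentalRep_mem_unitaryGroup) β (continuous_iterate_wilsonFlowRK3 ε' m).measurable
    (fun U => iterate_wilsonFlowRK3_negReflect ε' m U) s c a y hdep

/-- **THE FLOWED SLAB ENERGY ACROSS THE SITE PLANE**: with `E_{m,t} = Σ_{x : x₀ = t} S_x ∘ RK3_{ε'}^m` supported in the half-space
and any constant `a`, `0 ≤ ∫ (E_{m,t} − a)·((Σ_{x : x₀ = t} S_{θ'x} ∘ RK3^m) − a) dμ_β` — the second factor being the flowed energy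
of the mirror slice `−t`; every `β`, `ε'`, `m`. -/
theorem integral_rk3SlabEnergy_sub_mul_negReflect_nonneg (hL : Even L) (β ε' : ℝ) (m : ℕ) (t : ZMod L) (a : ℝ)
    (hdep : DependsOn (fun U : GaugeConfig 4 L (Matrix.specialUnitaryGroup (Fin n) ℂ) =>
        (∑ x ∈ Finset.univ.filter (fun x : Site 4 L => x 0 = t),
          flowedCloverEnergy (fundamentalRep (Fin n)) 0 x ((wilsonFlowRK3 ε')^[m] U)) - a)
      ((WilsonSiteRP.sitePosEdges ∪ WilsonSiteRP.sharedEdges : Finset (Edge 4 L)) : Set (Edge 4 L))) :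
    0 ≤ ∫ U, ((∑ x ∈ Finset.univ.filter (fun x : Site 4 L => x 0 = t),
          flowedCloverEnergy (fundamentalRep (Fin n)) 0 x ((wilsonFlowRK3 ε')^[m] U)) - a) *
        ((∑ x ∈ Finset.univ.filter (fun x : Site 4 L => x 0 = t),
          flowedCloverEnergy (fundamentalRep (Fin n)) 0 (Site.negReflect x) ((wilsonFlowRK3 ε')^[m] U)) - a)
      ∂(wilsonMeasure (d := 4) (L := L) (fundamentalRep (Fin n)) β) := by
  have h := integral_rk3Energy_sub_mul_negReflect_nonneg (n := n) hL β ε' m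
    (Finset.univ.filter (fun x : Site 4 L => x 0 = t)) (fun _ => 1) a id (by simpa using hdep)
  simpa using h

end RK3

end Summit.Ventures.LatticeQCDFlow.Exactness
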